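import Summits.KontsevichZagierPeriods.Zeta5Search.LaiSweepShard

/-!
# `κ₃` sweep certificate — shard file 071 of 127 (shards 497–503 of 889)

HONEST FRAMING. Systematic search; no irrationality claim unless certified. This file only checks,
by `decide +kernel`, shards 497–503 of the order-cell sweep of the `κ₃` point `(74, 2180, 444; δ74)`
(engine `LaiSweepEngine`, soundness `LaiSweepJump/Free/Eval/Shard/Kappa3`; a shard is `⟨regime, n,
p, q, p', q', Lo, Up⟩`: `n` cells from `p/q` to `p'/q'` with integer rate sums in `[Lo, Up]`, `K =
128`, `D = 2^40`). It draws NO conclusion: only the capstone `LaiKappa3SweepCert`, which needs all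
127 shard files, does. Kernel cost of this file ≈ 560 cells × 0.3 s.
-/

namespace Summit.KontsevichZagierPeriods.Zeta5Search.Sweep

set_option maxHeartbeats 100000000 in
/-- Shard 497: 80 cells of regime B from `174/343` to `119/234`.
[cite: Lai2024BallRivoal, §4 Lemma 4.3] -/
theorem shard497 :
    Shard.check 128 (2^40)
      ⟨true, 80, 174, 343, 119, 234, 14838428087842, 18178404296298⟩ = true := by
  decide +kernel

set_option maxHeartbeats 100000000 in
/-- Shard 498: 80 cells of regime B from `119/234` to `2449/4804`.
[cite: Lai2024BallRivoal, §4 Lemma 4.3] -/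
theorem shard498 :
    Shard.check 128 (2^40)
      ⟨true, 80, 119, 234, 2449, 4804, 14600605072847, 17903926578545⟩ = true := by
  decide +kernel

set_option maxHeartbeats 100000000 in
/-- Shard 499: 80 cells of regime B from `2449/4804` to `139/272`.
[cite: Lai2024BallRivoal, §4 Lemma 4.3] -/
theorem shard499 :
    Shard.check 128 (2^40)
      ⟨true, 80, 2449, 4804, 139, 272, 14687093574326, 18026883296992⟩ = true := by
  decide +kernel

set_option maxHeartbeats 100000000 in
/-- Shard 500: 80 cells of regime B from `139/272` to `104/203`.
[cite: Lai2024BallRivoal, §4 Lemma 4.3] -/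
theorem shard500 :
    Shard.check 128 (2^40)
      ⟨true, 80, 139, 272, 104, 203, 15135002873061, 18594577535044⟩ = true := by
  decide +kernel

set_option maxHeartbeats 100000000 in
/-- Shard 501: 80 cells of regime B from `104/203` to `208/405`.
[cite: Lai2024BallRivoal, §4 Lemma 4.3] -/
theorem shard501 :
    Shard.check 128 (2^40)
      ⟨true, 80, 104, 203, 208, 405, 14880414980875, 18299445231460⟩ = true := by
  decide +kernel

set_option maxHeartbeats 100000000 in
/-- Shard 502: 80 cells of regime B from `208/405` to `191/371`.
[cite: Lai2024BallRivoal, §4 Lemma 4.3] -/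
theorem shard502 :
    Shard.check 128 (2^40)
      ⟨true, 80, 208, 405, 191, 371, 14589197424021, 17958406936700⟩ = true := by
  decide +kernel

set_option maxHeartbeats 100000000 in
/-- Shard 503: 80 cells of regime B from `191/371` to `161/312`.
[cite: Lai2024BallRivoal, §4 Lemma 4.3] -/
theorem shard503 :
    Shard.check 128 (2^40)
      ⟨true, 80, 191, 371, 161, 312, 14059906408008, 17322907196518⟩ = true := by
  decide +kernel

/-- The checked shards of this file, in order. [folklore] -/
def shards071 : List (CheckedShard 128 (2^40)) :=
  [⟨_, shard497⟩, ⟨_, shard498⟩, ⟨_, shard499⟩, ⟨_, shard500⟩, ⟨_, shard501⟩,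
    ⟨_, shard502⟩, ⟨_, shard503⟩]

end Summit.KontsevichZagierPeriods.Zeta5Search.Sweep
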